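import Mathlib
import Summits.CriticalPhenomena.CardyFormulaZ2.Theses.CardyWhiteToColoured
import Literature.Probability.Percolation.SmoothedWhiteNoise
import Summits.CriticalPhenomena.CardyFormulaZ2.Theorems.CardyWhiteToColouredDriftBoundStubWhiteWindow
import Summits.CriticalPhenomena.CardyFormulaZ2.Theorems.CardyWhiteToColouredModelExists

/-!
# Line `three_windows` — crux `DriftBound` of route `CriticalPhenomena/CardyFormulaZ2/CardyWhiteToColoured`

Strategist line (unit `cstrat-stmt-CriticalPhenomena-4596-s1`, 2026-08-17), registered ALONGSIDE the
lead's live skeleton `Lines/birth.lean` (v4.1, one open stub `stub_pairEstimate`); it does not touch it.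

## Idea: three windows — the lattice piece has no `ℓ`, the continuum piece has no `δ`

`DriftBound` compares critical bond percolation on `δℤ²` (`P_δ(R)`) with the sign percolation of the
lattice white noise smoothed at a FIXED macroscopic scale `ℓ` (`P^latt_{ℓ,δ}(R)`), in the order
`δ → 0⁺` first, then `ℓ → 0⁺`.  The live line attacks the whole scale range `σ = s/δ ∈
[1/(1+|log δ|), ℓ₀/δ]` ON THE LATTICE (uniform Cauchy window `W`, equivalently the integrated
Plackett drift `stub_pairEstimate`).  This line cuts the range at the mesoscopic scale
`t(δ) = δ^{1/8}` (`σ = δ^{-7/8}`) and moves everything above the cut into the CONTINUUM: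

* `stub_latticeWindow` (C1, crux-sized, OPEN: lattice/mesoscopic two-model universality) — on the
  lattice only, no `ℓ`, no continuum object: smoothing the noise at any two scales
  `δ/(1+|log δ|) ≤ s₁ ≤ s₂ ≤ δ^{1/8}` changes the crossing probability of `R_δ` by `o(1)`;
* `stub_uniformDiscretisation` (C2, PROVABLE-class L/XL) — lattice-to-continuum coupling at a MOVING
  scale `s ≥ δ^{1/8}`: `|P^latt_{s,δ}(R) − P^cont_s(R)| → 0` uniformly in `s ∈ [δ^{1/8}, ℓ₀]`
  (Muirhead–Vanneuville 2020 Prop. 3.11-type sup-norm coupling of the normalised fields, error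
  `(δ/s)·polylog`, plus the Cameron–Martin bound `density(T) ≤ ‖h‖_H/√(2π) ≍ diam R / s` on the
  crossing threshold `T = sup_γ min_t f(γ t)`: total `≲ diam R · δ · s^{-2} · polylog ≤ δ^{3/4−}`);
  the fixed-`ℓ` case is the landed `NoiseDiscretisation` (p: `noiseDiscretisation_proof`);
* `stub_continuumScalingLimit` (C3, crux-sized, OPEN: Beliaev 2023 Conj. "Cardy/scaling limit for
  Bargmann–Fock-type percolation", here only EXISTENCE of `lim_{ℓ→0⁺} P^cont_ℓ(R)`) — in the
  continuum only, no lattice: by the landed similarity covariance (`EuclideanCovariance`) this is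
  `lim_{L→∞} P^cont_1(L·R)` for ONE smooth Gaussian field with Gaussian covariance.  It is a
  CONSEQUENCE of `DriftBound` (with the landed `NoiseDiscretisation`, `EuclideanCovariance`,
  `ModelExists`, as in `LimitPayoff`), hence strictly on the way, and it is where the continuum
  tools (Beliaev–Muirhead–Rivera covariance formula, continuum RSW of Muirhead–Vanneuville /
  Köhler-Schindler–Tassion, Cameron–Martin level-shifts) act without any lattice.

Glue (kernel-checked below, no sorry): with the landed white end/window `stub_whiteWindow` (B1,
`P_δ ≈ P^latt_{s⋆,δ}`, `s⋆ = δ/(1+|log δ|)`) and the landed `ModelExists` (a white noise `μ` and a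
Gaussian bump family `k` exist):
`P_δ ≈₍B1₎ P^latt_{s⋆,δ} ≈₍C1₎ P^latt_{t,δ} ≈₍C2₎ P^cont_t ≈₍C3₎ Ψ ≈₍C3₎ P^cont_ℓ ≈₍C2₎ P^latt_{ℓ,δ}`,
`t = δ^{1/8}`, six pieces of `ε/6`.

Why it dodges the live line's stuck goal: `stub_pairEstimate` must bound the Plackett pair
functional uniformly over ALL `σ ∈ [1/(1+|log δ|), ℓ₀/δ]`, including the macroscopic-`σ` regime where
the imbalance is a boundary/IIC ratio-limit RATE statement (`θ > 3/4`, rigorously `θ > 0`); here that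
regime is replaced by a `δ`-free continuum limit statement (C3) and a provable coupling (C2), and the
lattice statement C1 never sees `σ > δ^{-7/8}`.  What it does NOT dodge: the crossover regime
`σ ∈ [1/log, M]` (dependent self-dual percolation vs Bernoulli) sits inside C1 and is as hard as before.
-/

namespace Summit.CriticalPhenomena.CardyFormulaZ2.Cruxes.DriftBound.ThreeWindows

open Set Filter Topology MeasureTheory
open Literature.Probability.LatticeModels Literature.Probability.Percolation
open Literature.Probability.RandomPlanarGeometry

/-! ## The stubs -/

/-- **Stub C1 — the lattice window (OPEN-PROBLEM class: mesoscopic two-model universality on `ℤ²`).**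
For every conformal rectangle `R` and `ε > 0` there is `δ₀ > 0` such that for every mesh `δ < δ₀`
and all smoothing scales `δ/(1+|log δ|) ≤ s₁ ≤ s₂` with `s₂ ^ 8 ≤ δ` (i.e. `s₂ ≤ δ^{1/8}`), the
crossing probabilities of `R_δ` for the sign percolation of the lattice white noise smoothed at `s₁`
and at `s₂` differ by less than `ε`.  No `ℓ`, no continuum object.  Both models are exactly
self-dual, `D₄`-symmetric, positively associated, with uniform RSW (landed
`uniformRSW_signConfigLaw`); the content is that mesoscopic Gaussian smoothing (range `σ = s/δ` from
`1/log(1/δ)` to `δ^{-7/8}` lattice units) does not move macroscopic crossing probabilities — a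
universality statement for finite-range-dependent self-dual planar percolation, open even for
`σ = O(1)`. -/
theorem stub_latticeWindow :
    ∀ R : Literature.Probability.RandomPlanarGeometry.ConformalRectangle, ∀ ε : ℝ, 0 < ε →
      ∃ δ₀ : ℝ, 0 < δ₀ ∧ ∀ δ : ℝ, 0 < δ → δ < δ₀ →
        ∀ s₁ s₂ : ℝ, δ / (1 + |Real.log δ|) ≤ s₁ → s₁ ≤ s₂ → s₂ ^ 8 ≤ δ →
          |Literature.Probability.Percolation.smoothedCrossingProb s₂ δ R.carrier (R.arc 0) (R.arc 2)
            - Literature.Probability.Percolation.smoothedCrossingProb s₁ δ R.carrier (R.arc 0) (R.arc 2)| < ε := by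
  sorry

/-- **Stub C2 — uniform discretisation at a moving scale (PROVABLE class, L/XL).**  For every white
noise `μ`, Gaussian bump family `k`, conformal rectangle `R` and `ε > 0` there are `ℓ₀ > 0` and
`δ₀ > 0` such that for all `δ < δ₀` and all scales `s` with `δ ≤ s ^ 8` and `s ≤ ℓ₀`,
`|P^latt_{s,δ}(R) − P^cont_s(R)| < ε`.  The fixed-`s` statement is the landed `NoiseDiscretisation`;
uniformity down to `s = δ^{1/8}` needs the quantitative sup-norm coupling of the normalised lattice
and continuum fields on `R̄` (Muirhead–Vanneuville 2020, Prop. 3.11 / Lemma 3.14: error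
`(δ/s)·√log`) and the Cameron–Martin density bound for the crossing threshold (unit shift on `R̄` has
Cameron–Martin norm `≍ diam R / s`), total error `≲ diam R · δ / s² · polylog → 0` since `s ≥ δ^{1/8}`;
plus a quantitative version of the discrete-arc / mesh-domain approximation used at fixed `ℓ`. -/
theorem stub_uniformDiscretisation :
    ∀ μ : MeasureTheory.Measure (Literature.MathematicalPhysics.QuantumLattice.FieldConfig ℂ),
      Literature.Probability.Percolation.IsWhiteNoise μ →
      ∀ k : ℝ → ℂ → SchwartzMap ℂ ℝ, Literature.Probability.Percolation.IsGaussianBumpFamily k →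
        ∀ R : Literature.Probability.RandomPlanarGeometry.ConformalRectangle, ∀ ε : ℝ, 0 < ε →
          ∃ ℓ₀ : ℝ, 0 < ℓ₀ ∧ ∃ δ₀ : ℝ, 0 < δ₀ ∧ ∀ δ : ℝ, 0 < δ → δ < δ₀ →
            ∀ s : ℝ, 0 < s → δ ≤ s ^ 8 → s ≤ ℓ₀ →
              |Literature.Probability.Percolation.smoothedCrossingProb s δ R.carrier (R.arc 0) (R.arc 2)
                - Literature.Probability.Percolation.continuumCrossingProb μ k s R| < ε := by
  sorry

/-- **Stub C3 — the continuum scaling limit (OPEN-PROBLEM class: existence of the scaling limit of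
crossing probabilities for the sign percolation of Gaussian-smoothed planar white noise; Beliaev 2023,
Conj. 6.4 asks for Cardy's formula, we only need existence).**  For every white noise `μ`, Gaussian
bump family `k` and conformal rectangle `R`, `P^cont_ℓ(R)` converges as `ℓ → 0⁺`.  By the landed
similarity covariance this is `lim_{L → ∞} P^cont_1(L·R)` for one fixed smooth field; it follows from
`DriftBound` + `NoiseDiscretisation` + `EuclideanCovariance` + `ModelExists` (the argument of
`LimitPayoff`), so it is a genuine consequence of the crux, used here toward it.  No lattice, no `δ`. -/
theorem stub_continuumScalingLimit :
    ∀ μ : MeasureTheory.Measure (Literature.MathematicalPhysics.QuantumLattice.FieldConfig ℂ),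
      Literature.Probability.Percolation.IsWhiteNoise μ →
      ∀ k : ℝ → ℂ → SchwartzMap ℂ ℝ, Literature.Probability.Percolation.IsGaussianBumpFamily k →
        ∀ R : Literature.Probability.RandomPlanarGeometry.ConformalRectangle,
          ∃ Ψ : ℝ, Filter.Tendsto (fun ℓ : ℝ => Literature.Probability.Percolation.continuumCrossingProb μ k ℓ R)
            (nhdsWithin 0 (Set.Ioi 0)) (nhds Ψ) := by
  sorry

/-! ## Elementary scale bookkeeping -/

/-- The cut scale `s⋆ = δ/(1 + |log δ|)` of the white window is positive and at most `δ`. -/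
theorem cutScale_pos_le {δ : ℝ} (hδ : 0 < δ) :
    0 < δ / (1 + |Real.log δ|) ∧ δ / (1 + |Real.log δ|) ≤ δ := by
  have h1 : (1 : ℝ) ≤ 1 + |Real.log δ| := le_add_of_nonneg_right (abs_nonneg _)
  have hpos : (0 : ℝ) < 1 + |Real.log δ| := one_pos.trans_le h1
  exact ⟨div_pos hδ hpos, div_le_self hδ.le h1⟩

/-- The mesoscopic scale `t = δ^{1/8}`: positive, `t ^ 8 = δ`, and `δ ≤ t ≤ 1` when `δ ≤ 1`. -/
theorem mesoScale_spec {δ : ℝ} (hδ : 0 < δ) (hδ1 : δ ≤ 1) :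
    0 < δ ^ ((1 : ℝ) / 8) ∧ (δ ^ ((1 : ℝ) / 8)) ^ 8 = δ ∧ δ ≤ δ ^ ((1 : ℝ) / 8) ∧ δ ^ ((1 : ℝ) / 8) ≤ 1 := by
  have ht0 : 0 < δ ^ ((1 : ℝ) / 8) := Real.rpow_pos_of_pos hδ _
  have ht8 : (δ ^ ((1 : ℝ) / 8)) ^ 8 = δ := by
    rw [← Real.rpow_natCast, ← Real.rpow_mul hδ.le]
    norm_num
  have ht1 : δ ^ ((1 : ℝ) / 8) ≤ 1 := Real.rpow_le_one hδ.le hδ1 (by norm_num)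
  refine ⟨ht0, ht8, ?_, ht1⟩
  -- `δ = t ^ 8 ≤ t` because `0 ≤ t ≤ 1`
  calc δ = (δ ^ ((1 : ℝ) / 8)) ^ 8 := ht8.symm
    _ ≤ (δ ^ ((1 : ℝ) / 8)) ^ 1 := pow_le_pow_of_le_one ht0.le ht1 (by norm_num)
    _ = δ ^ ((1 : ℝ) / 8) := pow_one _

/-- From a right-limit at `0` to an `ε`-window: if `P ℓ → Ψ` as `ℓ → 0⁺` then for every `ε > 0`
there is `ℓ₁ > 0` with `|P ℓ − Ψ| < ε` for all `0 < ℓ < ℓ₁`. -/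
theorem window_of_tendsto {P : ℝ → ℝ} {Ψ : ℝ}
    (h : Filter.Tendsto P (nhdsWithin 0 (Set.Ioi 0)) (nhds Ψ)) {ε : ℝ} (hε : 0 < ε) :
    ∃ ℓ₁ : ℝ, 0 < ℓ₁ ∧ ∀ ℓ : ℝ, 0 < ℓ → ℓ < ℓ₁ → |P ℓ - Ψ| < ε := by
  have hev : ∀ᶠ ℓ in nhdsWithin 0 (Set.Ioi 0), dist (P ℓ) Ψ < ε := Metric.tendsto_nhds.1 h ε hε
  obtain ⟨u, hu, hsub⟩ := mem_nhdsGT_iff_exists_Ioo_subset.1 hev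
  refine ⟨u, hu, fun ℓ hℓ hℓu => ?_⟩
  have := hsub ⟨hℓ, hℓu⟩
  simpa [Real.dist_eq] using this

/-! ## Glue: the three windows give the crux -/

/-- **`DriftBound` from the three windows** (sorry-free; uses the LANDED white window
`Birth.stub_whiteWindow` and the LANDED `ModelExists`).  For `ε > 0`: `Ψ, ℓ₁` from C3 (twice, at
`t` and at `ℓ`), `ℓ₂, δ₂` from C2, `δ₁` from C1, `δ₃` from B1; `ℓ₀ := min ℓ₁ ℓ₂`; given `ℓ < ℓ₀`,
`δ₀ := min (min (min δ₁ δ₂) (min δ₃ 1)) (ℓ ^ 8)`; for `δ < δ₀` put `s⋆ = δ/(1+|log δ|)`,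
`t = δ^{1/8}` (`s⋆ ≤ δ ≤ t ≤ ℓ`), and chain the six `ε/6`-estimates. -/
theorem DriftBound_of
    (hC1 : ∀ R : Literature.Probability.RandomPlanarGeometry.ConformalRectangle, ∀ ε : ℝ, 0 < ε →
      ∃ δ₀ : ℝ, 0 < δ₀ ∧ ∀ δ : ℝ, 0 < δ → δ < δ₀ →
        ∀ s₁ s₂ : ℝ, δ / (1 + |Real.log δ|) ≤ s₁ → s₁ ≤ s₂ → s₂ ^ 8 ≤ δ →
          |Literature.Probability.Percolation.smoothedCrossingProb s₂ δ R.carrier (R.arc 0) (R.arc 2)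
            - Literature.Probability.Percolation.smoothedCrossingProb s₁ δ R.carrier (R.arc 0) (R.arc 2)| < ε)
    (hC2 : ∀ μ : MeasureTheory.Measure (Literature.MathematicalPhysics.QuantumLattice.FieldConfig ℂ),
      Literature.Probability.Percolation.IsWhiteNoise μ →
      ∀ k : ℝ → ℂ → SchwartzMap ℂ ℝ, Literature.Probability.Percolation.IsGaussianBumpFamily k →
        ∀ R : Literature.Probability.RandomPlanarGeometry.ConformalRectangle, ∀ ε : ℝ, 0 < ε →
          ∃ ℓ₀ : ℝ, 0 < ℓ₀ ∧ ∃ δ₀ : ℝ, 0 < δ₀ ∧ ∀ δ : ℝ, 0 < δ → δ < δ₀ →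
            ∀ s : ℝ, 0 < s → δ ≤ s ^ 8 → s ≤ ℓ₀ →
              |Literature.Probability.Percolation.smoothedCrossingProb s δ R.carrier (R.arc 0) (R.arc 2)
                - Literature.Probability.Percolation.continuumCrossingProb μ k s R| < ε)
    (hC3 : ∀ μ : MeasureTheory.Measure (Literature.MathematicalPhysics.QuantumLattice.FieldConfig ℂ),
      Literature.Probability.Percolation.IsWhiteNoise μ →
      ∀ k : ℝ → ℂ → SchwartzMap ℂ ℝ, Literature.Probability.Percolation.IsGaussianBumpFamily k →
        ∀ R : Literature.Probability.RandomPlanarGeometry.ConformalRectangle,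
          ∃ Ψ : ℝ, Filter.Tendsto (fun ℓ : ℝ => Literature.Probability.Percolation.continuumCrossingProb μ k ℓ R)
            (nhdsWithin 0 (Set.Ioi 0)) (nhds Ψ)) :
    Summit.CriticalPhenomena.CardyFormulaZ2.Theses.CardyWhiteToColoured.DriftBound := by
  -- the model: a white noise `μ` and a Gaussian bump family `k` (landed `ModelExists`)
  obtain ⟨⟨μ, hμG, hμgen⟩, k, hk⟩ :=
    Summit.CriticalPhenomena.CardyFormulaZ2.Theorems.cardyWhiteToColoured_modelExists_proof
  have hμ : Literature.Probability.Percolation.IsWhiteNoise μ := ⟨hμG, hμgen⟩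
  have hk' : Literature.Probability.Percolation.IsGaussianBumpFamily k := hk
  intro R ε hε
  have hε6 : (0 : ℝ) < ε / 6 := by positivity
  -- C3: the continuum limit `Ψ` and its window `ℓ₁`
  obtain ⟨Ψ, hΨ⟩ := hC3 μ hμ k hk' R
  obtain ⟨ℓ₁, hℓ₁, H3⟩ := window_of_tendsto hΨ hε6
  -- C2, C1, B1
  obtain ⟨ℓ₂, hℓ₂, δ₂, hδ₂, H2⟩ := hC2 μ hμ k hk' R (ε / 6) hε6
  obtain ⟨δ₁, hδ₁, H1⟩ := hC1 R (ε / 6) hε6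
  obtain ⟨δ₃, hδ₃, HB⟩ :=
    Summit.CriticalPhenomena.CardyFormulaZ2.Cruxes.DriftBound.Birth.stub_whiteWindow R (ε / 6) hε6
  refine ⟨min ℓ₁ ℓ₂, lt_min hℓ₁ hℓ₂, fun ℓ hℓ hℓlt => ?_⟩
  have hℓ1 : ℓ < ℓ₁ := lt_of_lt_of_le hℓlt (min_le_left _ _)
  have hℓ2 : ℓ < ℓ₂ := lt_of_lt_of_le hℓlt (min_le_right _ _)
  refine ⟨min (min (min δ₁ δ₂) (min δ₃ 1)) (ℓ ^ 8),
    lt_min (lt_min (lt_min hδ₁ hδ₂) (lt_min hδ₃ one_pos)) (pow_pos hℓ 8), fun δ hδ hδlt => ?_⟩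
  have hδ₁' : δ < δ₁ :=
    lt_of_lt_of_le hδlt ((min_le_left _ _).trans ((min_le_left _ _).trans (min_le_left _ _)))
  have hδ₂' : δ < δ₂ :=
    lt_of_lt_of_le hδlt ((min_le_left _ _).trans ((min_le_left _ _).trans (min_le_right _ _)))
  have hδ₃' : δ < δ₃ :=
    lt_of_lt_of_le hδlt ((min_le_left _ _).trans ((min_le_right _ _).trans (min_le_left _ _)))
  have hδone : δ ≤ 1 :=
    (lt_of_lt_of_le hδlt ((min_le_left _ _).trans ((min_le_right _ _).trans (min_le_right _ _)))).le
  have hδℓ8 : δ ≤ ℓ ^ 8 := (lt_of_lt_of_le hδlt (min_le_right _ _)).le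
  -- the scales `s⋆ ≤ δ ≤ t ≤ ℓ`
  obtain ⟨hspos, hsle⟩ := cutScale_pos_le hδ
  set s := δ / (1 + |Real.log δ|) with hs
  obtain ⟨ht0, ht8, hδt, ht1⟩ := mesoScale_spec hδ hδone
  set t := δ ^ ((1 : ℝ) / 8) with ht
  have hst : s ≤ t := hsle.trans hδt
  have htℓ : t ≤ ℓ := by
    have : t ^ 8 ≤ ℓ ^ 8 := by rw [ht8]; exact hδℓ8
    exact le_of_pow_le_pow_left₀ (by norm_num) hℓ.le this
  -- the six pieces
  have p1 : |smoothedCrossingProb s δ R.carrier (R.arc 0) (R.arc 2) - bondDomainCrossingProb R δ| < ε / 6 :=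
    HB δ hδ hδ₃' s hspos le_rfl
  have p2 : |smoothedCrossingProb t δ R.carrier (R.arc 0) (R.arc 2)
      - smoothedCrossingProb s δ R.carrier (R.arc 0) (R.arc 2)| < ε / 6 :=
    H1 δ hδ hδ₁' s t le_rfl hst ht8.le
  have p3 : |smoothedCrossingProb t δ R.carrier (R.arc 0) (R.arc 2) - continuumCrossingProb μ k t R| < ε / 6 :=
    H2 δ hδ hδ₂' t ht0 ht8.ge (htℓ.trans hℓ2.le)
  have p4 : |continuumCrossingProb μ k t R - Ψ| < ε / 6 := H3 t ht0 (htℓ.trans_lt hℓ1)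
  have p5 : |continuumCrossingProb μ k ℓ R - Ψ| < ε / 6 := H3 ℓ hℓ hℓ1
  have p6 : |smoothedCrossingProb ℓ δ R.carrier (R.arc 0) (R.arc 2) - continuumCrossingProb μ k ℓ R| < ε / 6 :=
    H2 δ hδ hδ₂' ℓ hℓ hδℓ8 hℓ2.le
  have h : |bondDomainCrossingProb R δ - smoothedCrossingProb ℓ δ R.carrier (R.arc 0) (R.arc 2)| < ε := by
    have q1 := abs_sub_lt_iff.1 p1
    have q2 := abs_sub_lt_iff.1 p2
    have q3 := abs_sub_lt_iff.1 p3
    have q4 := abs_sub_lt_iff.1 p4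
    have q5 := abs_sub_lt_iff.1 p5
    have q6 := abs_sub_lt_iff.1 p6
    rw [abs_sub_lt_iff]
    constructor <;> linarith
  rw [smoothedCrossingProb_conformalRectangle_eq] at h
  exact h

/-- **The skeleton as a (conditional) proof of the crux** — the shape audited by
`ledger skeleton check`: no hypotheses, concludes `DriftBound` BY NAME, reaches it from the three
declared stubs only (plus landed tree theorems). -/
theorem driftBound_of_stubs :
    Summit.CriticalPhenomena.CardyFormulaZ2.Theses.CardyWhiteToColoured.DriftBound :=
  DriftBound_of stub_latticeWindow stub_uniformDiscretisation stub_continuumScalingLimit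

end Summit.CriticalPhenomena.CardyFormulaZ2.Cruxes.DriftBound.ThreeWindows
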